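import Mathlib
import Summits.Ventures.PercRepro2.Graph
import Summits.Ventures.PercRepro2.HCov
import Summits.Ventures.PercRepro2.CutVertexPaths

/-!
# One mark behind a cut vertex, I: the reduced pendant graph and its connectivity
(blind cell PercRepro2, typer-1 g48)

Towards THE ONE-FAR-MARK EQUIVALENCE of S3 §12.2 ((G5) of proofs/CRUX-SUBCLAIMS.md).  Let `v` be
a cut vertex between the left side `L` and the right side `Rt` (p3 g16's `CutVertex`: every edge
has a side, left edges live on `L ∪ {v}`, right edges on `Rt ∪ {v}`), and let the mark `w` lie in
`L`.  The REDUCED graph `rends` has the right edges and ONE pendant edge `{v, w}` (edge type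
`REdge side = {e // side e = false} ⊕ Unit`), and the configuration map `Ψ` restricts to the right
edges and records on the pendant edge whether `w` reaches `v` by left edges.

* **`Gc_transport_marks'`**: the marks-only transport of `GcTransportMarks.lean` across two edge
  types;
* **`cutVertex_reduced`**: the reduced graph is itself a cut-vertex graph with left side `{w}`;
* **`conn_marks_iff`**: for marks that are `w` or lie in `Rt ∪ {v}`, connectivity in `G` under `ω`
  is connectivity in the reduced graph under `Ψ ω` (`conn_cross_iff` / `conn_iff_restrict_right`
  on both sides; the right-restricted open graphs coincide, `openGraph_restrict_eq`).

The law of `Ψ` and the equivalence itself follow in `CutOneFar.lean`.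
-/

namespace Summit.Ventures.PercRepro2

open CovForm CutVertexM9

namespace CutOneFar

/-! ## Transport of the covariance form across edge types, marks only -/

section Transport

variable {V : Type*} {E : Type*} {E' : Type*} [Fintype E] [DecidableEq E] [Fintype E']
  [DecidableEq E'] {R : Type*} [Field R]

omit [Fintype E] [DecidableEq E] [Fintype E'] [DecidableEq E'] in
/-- Preimage of a connection event between two marks. -/
lemma preimage_connEvent_of_mem' {ends : E → Sym2 V} {ends' : E' → Sym2 V}
    {Ψ : Config E' → Config E} {M : Set V}
    (hH : ∀ ω, ∀ x ∈ M, ∀ z ∈ M, Conn ends (Ψ ω) x z ↔ Conn ends' ω x z) {x z : V} (hx : x ∈ M)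
    (hz : z ∈ M) : Ψ ⁻¹' connEvent ends x z = connEvent ends' x z := by
  ext ω
  simp [hH ω x hx z hz]

omit [Fintype E] [DecidableEq E] [Fintype E'] [DecidableEq E'] in
/-- Preimage of a one-point avoidance event between marks. -/
lemma preimage_avoidAll_singleton_of_mem' {ends : E → Sym2 V} {ends' : E' → Sym2 V}
    {Ψ : Config E' → Config E} {M : Set V}
    (hH : ∀ ω, ∀ x ∈ M, ∀ z ∈ M, Conn ends (Ψ ω) x z ↔ Conn ends' ω x z) {s x : V} (hs : s ∈ M)
    (hx : x ∈ M) : Ψ ⁻¹' avoidAll ends s {x} = avoidAll ends' s {x} := by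
  ext ω
  simp [avoidAll, hH ω s hs x hx]

omit [Fintype E] [DecidableEq E] [Fintype E'] [DecidableEq E'] in
/-- Preimage of `PDEvent` between marks. -/
lemma preimage_PDEvent_of_mem' {ends : E → Sym2 V} {ends' : E' → Sym2 V}
    {Ψ : Config E' → Config E} {M : Set V}
    (hH : ∀ ω, ∀ x ∈ M, ∀ z ∈ M, Conn ends (Ψ ω) x z ↔ Conn ends' ω x z) {a₁ a₂ a₃ : V}
    (h1 : a₁ ∈ M) (h2 : a₂ ∈ M) (h3 : a₃ ∈ M) :
    Ψ ⁻¹' PDEvent ends a₁ a₂ a₃ = PDEvent ends' a₁ a₂ a₃ := by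
  simp only [PDEvent, Dtilde, UnionCluster.inU, Set.preimage_inter, Set.preimage_compl,
    Set.preimage_union, preimage_connEvent_of_mem' hH h1 h2, preimage_connEvent_of_mem' hH h3 h1,
    preimage_connEvent_of_mem' hH h3 h2]

omit [Fintype E] [DecidableEq E] [Fintype E'] [DecidableEq E'] in
/-- Preimage of `TEvent` between marks. -/
lemma preimage_TEvent_of_mem' {ends : E → Sym2 V} {ends' : E' → Sym2 V}
    {Ψ : Config E' → Config E} {M : Set V}
    (hH : ∀ ω, ∀ x ∈ M, ∀ z ∈ M, Conn ends (Ψ ω) x z ↔ Conn ends' ω x z) {a₁ a₂ a₃ : V}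
    (h1 : a₁ ∈ M) (h2 : a₂ ∈ M) (h3 : a₃ ∈ M) :
    Ψ ⁻¹' TEvent ends a₁ a₂ a₃ = TEvent ends' a₁ a₂ a₃ := by
  simp only [TEvent, Set.preimage_inter, Set.preimage_compl, preimage_connEvent_of_mem' hH h2 h1,
    preimage_connEvent_of_mem' hH h2 h3]

/-- **Transport of the covariance form across edge types, marks only**: `P_q(A) = P_p(Ψ⁻¹ A)` for
every event and `Ψ` transports connectivity between the five marks ⟹ `Gc` is carried along. -/
theorem Gc_transport_marks' {q : E → R} {p : E' → R} {ends : E → Sym2 V} {ends' : E' → Sym2 V}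
    {Ψ : Config E' → Config E} (hP : ∀ A : Set (Config E), prob q A = prob p (Ψ ⁻¹' A))
    (o a₁ a₂ a₃ b : V)
    (hH : ∀ ω, ∀ x ∈ ({o, a₁, a₂, a₃, b} : Set V), ∀ z ∈ ({o, a₁, a₂, a₃, b} : Set V),
      Conn ends (Ψ ω) x z ↔ Conn ends' ω x z) :
    Gc q ends o a₁ a₂ a₃ b = Gc p ends' o a₁ a₂ a₃ b := by
  have ho : o ∈ ({o, a₁, a₂, a₃, b} : Set V) := by simp
  have h1 : a₁ ∈ ({o, a₁, a₂, a₃, b} : Set V) := by simp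
  have h2 : a₂ ∈ ({o, a₁, a₂, a₃, b} : Set V) := by simp
  have h3 : a₃ ∈ ({o, a₁, a₂, a₃, b} : Set V) := by simp
  have hb : b ∈ ({o, a₁, a₂, a₃, b} : Set V) := by simp
  simp only [Gc, DEF, EQbo, EQb3, EQb3o, EQo, EQ3, EQ3o, PDb, PDbo, Do, gap, hP,
    Set.preimage_inter, preimage_PDEvent_of_mem' hH h1 h2 h3, preimage_TEvent_of_mem' hH h1 h2 h3,
    preimage_TEvent_of_mem' hH h2 h1 h3, preimage_connEvent_of_mem' hH h1 ho,
    preimage_connEvent_of_mem' hH h2 ho, preimage_connEvent_of_mem' hH h1 hb,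
    preimage_connEvent_of_mem' hH h2 hb, preimage_avoidAll_singleton_of_mem' hH h2 h1]

end Transport

/-! ## The reduced graph: the right side plus one pendant edge -/

section Reduced

variable {V : Type*} {E : Type*} [Fintype E] [DecidableEq E]

/-- The edge type of the reduced graph: the right edges and one pendant edge. -/
abbrev REdge (side : E → Bool) : Type _ := {e : E // side e = false} ⊕ Unit

/-- The reduced graph: the right edges as they are, and the pendant edge `{v, w}`. -/
def rends (ends : E → Sym2 V) (side : E → Bool) (v w : V) : REdge side → Sym2 V
  | Sum.inl e => ends e.1
  | Sum.inr _ => s(v, w)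

/-- The sides of the reduced graph: the pendant edge is the left side. -/
def rside (side : E → Bool) : REdge side → Bool
  | Sum.inl _ => false
  | Sum.inr _ => true

omit [Fintype E] [DecidableEq E] in
/-- The reduced graph is a cut-vertex graph with left side `{w}`. -/
lemma cutVertex_reduced {ends : E → Sym2 V} {side : E → Bool} {L : Set V} {v : V} {Rt : Set V}
    (h : CutVertex ends side L v Rt) {w : V} (hw : w ∈ L) :
    CutVertex (rends ends side v w) (rside side) {w} v Rt where
  left := by
    rintro (e | e) he x hx
    · exact absurd he (by simp [rside])
    · simp only [rends, Sym2.mem_iff] at hx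
      rcases hx with rfl | rfl
      · exact Or.inr rfl
      · exact Or.inl rfl
  right := by
    rintro (e | e) he x hx
    · exact h.right e.1 e.2 x hx
    · exact absurd he (by simp [rside])
  disj := fun x hx hx' => h.disj x (by rw [Set.mem_singleton_iff] at hx; exact hx ▸ hw) hx'
  vL := fun hv => h.vL (by rw [Set.mem_singleton_iff] at hv; exact hv ▸ hw)
  vR := h.vR

open scoped Classical in
/-- The configuration map: restriction to the right edges, and on the pendant edge whether `w`
reaches `v` by left edges. -/
noncomputable def Ψ (ends : E → Sym2 V) (side : E → Bool) (v w : V) (ω : Config E) :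
    Config (REdge side)
  | Sum.inl e => ω e.1
  | Sum.inr _ => decide (Conn ends (CutVertexM9.restrict side true ω) w v)

omit [Fintype E] [DecidableEq E] in
/-- `Ψ` on a right edge. -/
lemma Ψ_inl (ends : E → Sym2 V) (side : E → Bool) (v w : V) (ω : Config E)
    (e : {e : E // side e = false}) : Ψ ends side v w ω (Sum.inl e) = ω e.1 := rfl

omit [Fintype E] [DecidableEq E] in
/-- `Ψ` on the pendant edge. -/
lemma Ψ_inr_eq_true_iff (ends : E → Sym2 V) (side : E → Bool) (v w : V) (ω : Config E) :
    Ψ ends side v w ω (Sum.inr ()) = true ↔ Conn ends (CutVertexM9.restrict side true ω) w v := by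
  simp [Ψ]

variable {ends : E → Sym2 V} {side : E → Bool} {L : Set V} {v : V} {Rt : Set V} {w : V}

omit [Fintype E] [DecidableEq E] in
/-- The right-restricted open graphs of `G` and of the reduced graph coincide. -/
lemma openGraph_restrict_eq (ω : Config E) :
    openGraph (rends ends side v w) (CutVertexM9.restrict (rside side) false (Ψ ends side v w ω)) =
      openGraph ends (CutVertexM9.restrict side false ω) := by
  ext x y
  simp only [openGraph_adj, OpenAdj, CutVertexM9.restrict]
  constructor
  · rintro ⟨hxy, e', he', hends⟩
    refine ⟨hxy, ?_⟩
    rcases e' with e | e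
    · refine ⟨e.1, ?_, hends⟩
      simp only [rside, if_true, Ψ_inl] at he'
      simp [e.2, he']
    · exact absurd he' (by simp [rside])
  · rintro ⟨hxy, e, he, hends⟩
    refine ⟨hxy, ?_⟩
    by_cases hs : side e = false
    · refine ⟨Sum.inl ⟨e, hs⟩, ?_, hends⟩
      simp only [rside, if_true, Ψ_inl]
      simpa [hs] using he
    · simp [hs] at he

omit [Fintype E] [DecidableEq E] in
/-- Connectivity between right vertices (and `v`) is the same in `G` and in the reduced graph. -/
lemma conn_right_iff (h : CutVertex ends side L v Rt) (hw : w ∈ L) (ω : Config E) {x z : V}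
    (hx : x ∈ Rt ∨ x = v) (hz : z ∈ Rt ∨ z = v) :
    Conn (rends ends side v w) (Ψ ends side v w ω) x z ↔ Conn ends ω x z := by
  rw [conn_iff_restrict_right (cutVertex_reduced h hw) hx hz, conn_iff_restrict_right h hx hz,
    Conn, Conn, openGraph_restrict_eq]

omit [Fintype E] [DecidableEq E] in
/-- In the reduced graph, `w ↔ v` iff the pendant edge is open. -/
lemma conn_pendant_iff (h : CutVertex ends side L v Rt) (hw : w ∈ L) (ω : Config E) :
    Conn (rends ends side v w) (Ψ ends side v w ω) w v ↔
      Conn ends (CutVertexM9.restrict side true ω) w v := by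
  rw [← Ψ_inr_eq_true_iff]
  constructor
  · intro hc
    by_contra hfalse
    have hfalse' : Ψ ends side v w ω (Sum.inr ()) = false := by simpa using hfalse
    -- with the pendant edge closed, `w` has no open left edge at all in the reduced graph
    have hc' := (conn_iff_restrict_left (cutVertex_reduced h hw) (Or.inl rfl) (Or.inr rfl) _).1 hc
    have hvw : v ≠ w := fun hvw => h.vL (hvw ▸ hw)
    refine hvw (mem_of_conn_of_closed (S := {w}) ?_ rfl hc')
    intro x hx y hxy
    rw [openGraph_adj] at hxy
    obtain ⟨_, e', he', _⟩ := hxy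
    rcases e' with e | e
    · simp [CutVertexM9.restrict, rside] at he'
    · simp [CutVertexM9.restrict, rside, hfalse'] at he'
  · intro hopen
    exact conn_of_openAdj ⟨Sum.inr (), hopen, Sym2.eq_swap⟩

omit [Fintype E] [DecidableEq E] in
/-- Connectivity between `w` and a right vertex (or `v`) is the same in `G` and in the reduced
graph. -/
lemma conn_cross_iff' (h : CutVertex ends side L v Rt) (hw : w ∈ L) (ω : Config E) {z : V}
    (hz : z ∈ Rt ∨ z = v) :
    Conn (rends ends side v w) (Ψ ends side v w ω) w z ↔ Conn ends ω w z := by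
  rw [conn_cross_iff (cutVertex_reduced h hw) (Or.inl rfl) hz, conn_cross_iff h (Or.inl hw) hz,
    conn_pendant_iff h hw, conn_right_iff h hw ω hz (Or.inr rfl),
    ← conn_iff_restrict_left h (Or.inl hw) (Or.inr rfl)]

omit [Fintype E] [DecidableEq E] in
/-- **Connectivity between marks is the same in `G` and in the reduced graph**, for marks that
are `w` or lie in `Rt ∪ {v}`. -/
theorem conn_marks_iff (h : CutVertex ends side L v Rt) (hw : w ∈ L) (ω : Config E) {x z : V}
    (hx : x = w ∨ x ∈ Rt ∨ x = v) (hz : z = w ∨ z ∈ Rt ∨ z = v) :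
    Conn (rends ends side v w) (Ψ ends side v w ω) x z ↔ Conn ends ω x z := by
  rcases hx with rfl | hx <;> rcases hz with rfl | hz
  · exact ⟨fun _ => conn_refl _ _ _, fun _ => conn_refl _ _ _⟩
  · exact conn_cross_iff' h hw ω hz
  · constructor
    · intro hc
      exact conn_symm ((conn_cross_iff' h hw ω hx).1 (conn_symm hc))
    · intro hc
      exact conn_symm ((conn_cross_iff' h hw ω hx).2 (conn_symm hc))
  · exact conn_right_iff h hw ω hx hz

end Reduced


end CutOneFar

end Summit.Ventures.PercRepro2
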